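import Mathlib
import Literature.AlgebraicGeometry.Resolution.WeightedResolutionDatum
import Literature.AlgebraicGeometry.Resolution.MarkedIdeals
import HarnessLib

/-!
# Abramovich–Quek–Schober 2025: the unique lex-maximal weighted centre of a hypersurface at a point of
# height two, its stability under separable base change, and the order drop under its weighted blow-up

Topic: `Literature/AlgebraicGeometry/Resolution`.  D. Abramovich, M. H. Quek, B. Schober, *Torus actions,
weighted blow-ups, and desingularization of plane curves*, arXiv:2507.01232 (2025; **v3 of 9 May 2026 = "final version,
accepted for publication in Math. Scand."**, 21 pp. — see the VERSION NOTE at the end of this docstring) [cite: AbramovichQuekSchober2025]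
(locators = page + line of the arXiv v1 PDF, 12 pp., res-lit-5 cross-read sheet `HOME/lit/res-lit-5/AQS2025-T-e1-F-XREAD.md`;
the held TeX text `paper:arxiv-2507.01232` was read chunk by chunk: p0003 = §1, p0005 = §2, p0007–p0008 = §3, p0009 = §4,
p0011–p0012 = §5; the v3 page + line locators of every cited item are tabulated in the VERSION NOTE).  NAMED FACTS (statements only; users take them as hypotheses), wanted by the e-ladder rung
`e = 1` of the door `HypersurfaceCentreConstruction` of route `ResolutionOfSingularities/WeightedInvariant`
(plan `D/res-D-pv-025/DOOR-ELADDER-PLAN.md`, item T-e1-F).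

## What is printed

* **Theorem 1.3** (v1 p. 2 L46 – p. 3 L4): "Let `C ⊂ S` be a hypersurface in a regular 2-dimensional scheme `S` essentially of
  finite type over a field `k`. Let `q ∈ C` be a singular closed point such that the reduction `C_red` of `C` is
  singular at `q`. (1) There is a well-defined, unique center `J = (x₁^{a₁}, x₂^{a₂})` of maximal invariant
  `(a₁, a₂)` admissible for `C ⊂ S` at `q`, where `a₁` is the order of `C` at `q`. Moreover, `J` is stable under
  base change to separable field extensions of `k`. (2) Let `J̄ = (x₁^{1/w₁}, x₂^{1/w₂})` be the associated reduced
  center. Its stack-theoretic weighted blow-up `S' = Bl_J̄(S) → S` is a proper birational morphism from a smooth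
  Artin stack `S'` which is a global quotient of a variety by `𝔾ₘ`, in particular tame. (3) The order of the proper
  transform of `C` at every point of the blow-up lying over `q` is strictly smaller than `a₁`."
* **Definition 3.3 / Remark 3.4** (p. 6 L31 – p. 7 L11): `J = (x₁^{a₁}, x₂^{a₂})` is the MONOMIAL VALUATION `v_J(x₁) = 1/a₁`,
  `v_J(x₂) = 1/a₂` for a regular system of parameters `(x₁, x₂)`; `J` is ADMISSIBLE for `f` iff `v_J(f) ≥ 1`, iff
  `f ∈ (x₁^{a₁}, x₂^{a₂})^{Int}`; **Definition 3.2** (p. 6 L19–L26): the invariant `(a₁, a₂) = (ν, δν) ∈ ℤ_{≥0} × (1/a₁!) ℤ_{≥0}`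
  with the LEXICOGRAPHIC order, `ν` the order, `δ` the vertex of Hironaka's characteristic polyhedron.
* **Theorem 3.5** (p. 7 L12–L19; proof p. 7 L21 – p. 8 L40): "`J = (x₁^{a₁}, x₂^{a₂})` is the unique admissible center for `f` for which `(a₁, a₂)`
  with `a₁ ≤ a₂` attains its maximum with respect to the lexicographical order. Moreover, `J` is stable under base
  change to separable field extensions of `k`." Proof (c) (p. 7 L85–L93): two admissible centres with the same invariant
  have `(x₁^{m a₁}, x₂^{m a₂})^{Int} = (y₁^{m a₁}, y₂^{m a₂})^{Int}` for every `m`.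
* **Definition 4.1 / §4** (p. 8 L65–L80; `𝓘ₙ` p. 8 L88; p. 9 L3, L43–L49; Def. 4.5 p. 10 L24): reduced centre `J̄ = (x₁^{1/w₁}, x₂^{1/w₂})`, `w₁, w₂` coprime positive
  integers with `ℓ · (1/w₁, 1/w₂) = (a₁, a₂)`, `ℓ = a₁w₁ = a₂w₂`; Rees pieces `𝓘ₙ = {g | v_J̄(g) ≥ n}`; the
  weighted blow-up is `[B₊/𝔾ₘ]`, `B = Spec_S ⊕ₙ 𝓘ₙ`, `B₊ = B ∖ V(x₁', x₂')`; "This local construction becomes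
  global via `𝓘ₙ = 𝒪_S` away from `q`."
* **Theorem 1.1** (p. 2 L3–L27) is the `T = 𝔾ₘⁿ`-EQUIVARIANT version along a singular closed orbit `𝒬` of a
  hypersurface `𝒵 ⊂ 𝒲`, `𝒲` regular of dimension `n + 2`; its proof (§5, p. 11 L3 – p. 12 L6) "passes to the localization at
  the generic point `q := η_𝒬` of `𝒬`, namely `C := Spec 𝒪_{𝒵,q}` and `S := Spec 𝒪_{𝒲,q}`. Then `S` is a
  2-dimensional regular scheme that is essentially of finite type over `k` … the residue field of the closed point
  `q ∈ S` is the function field `K(𝒬)` and hence it is not necessarily perfect", applies Theorem 1.3 there, and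
  extends `J` along `𝒬` by `T(k^sep)`-density using the uniqueness and the separable-base-change stability.

## What is recorded (special case, in the tree's vocabulary; weaker than printed)

The LOCAL statement AT A POINT `η` OF HEIGHT TWO of a scheme `Y` locally of finite type over a field `k` whose local
ring `𝒪_{Y,η}` is regular of dimension `2` — this is Theorem 1.3 for the scheme `S = Spec 𝒪_{Y,η}` (essentially of
finite type over `k`; its closed point is `η`, residue field `κ(η)` arbitrary), i.e. exactly the form in which §5 uses
it.  Admissibility `v_J̄(f) ≥ ℓ` is recorded through the tree's monomial ideals
`weightedMonomialIdeal x w n = (x^α : w·α ≥ n)` (`= 𝓘ₙ`, Włodarczyk Lemma 2.1.12, the convention of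
`ReesAlgebraData.IsWeightedChart`); the invariant `(a₁, a₂) = (ℓ/w₁, ℓ/w₂)` is compared lexicographically after
clearing denominators; the hypersurface is an ideal sheaf `X` whose stalk `X_η ⊆ 𝒪_{Y,η}` is principal and non-zero;
"`C_red` singular at `η`" is recorded as "`X_η` is not `(y^ν)` for a regular parameter `y`" (§2 p. 4 L47–L48: "`δ = ∞` if
and only if `f = ε y^ν` for some unit `ε` … In this case the reduction of `{f = 0}` is regular"; `ν = 0`, i.e. `X_η ≠ ⊤`,
is how "`q ∈ C`" enters); the weighted
blow-up and the proper (= strict) transform are the tree's cobordant `B₊` of a weighted chart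
(`ReesAlgebraData.cobordantPlus / cobordantStrictTransform`), on which the order is read — the printed statement
on the stack `[B₊/𝔾ₘ]` is the same statement on its smooth cover `B₊` ("Since the order is functorial for smooth
morphisms, showing that the order drops on `B₊` implies that it drops on the quotient", p. 10 L60–L62).  The chart
`(V, U)` is SOME affine neighbourhood of `η` (shrunk into the locus where `(u₀, u₁)` cuts out the closure of `η` regularly);
consumers must not expect a prescribed `U`.

* `IsLexMaxWeightedCentreGerm 𝒪 I x w ℓ` (a predicate, parameters): `(x₀, x₁)` is a regular system of parameters
  of the local ring `𝒪`, `(w₀, w₁)` are coprime positive weights with `w₁ ≤ w₀` (i.e. `a₁ = ℓ/w₀ ≤ a₂ = ℓ/w₁`),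
  `ℓ > 0`, `w₀ ∣ ℓ` (`a₁ ∈ ℤ`); ADMISSIBLE: `I ⊆ (x^α : w·α ≥ ℓ)`; LEX-MAXIMAL: every admissible `(y; w'; ℓ')`
  with `ℓ'/w'₀ ≤ ℓ'/w'₁` has `(ℓ'/w'₀, ℓ'/w'₁) ≤_lex (ℓ/w₀, ℓ/w₁)`; UNIQUE: every regular system of parameters `y`
  for which the same reduced data `(w, ℓ)` is admissible defines the same Rees filtration,
  `(y^α : w·α ≥ n) = (x^α : w·α ≥ n)` for all `n` (Thm 3.5, proof (c)).
* `AbramovichQuekSchober2025_heightTwoCentre` — Thm 1.3 (1)+(3) at a height-two point (= Thm 1.1 (1)+(3)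
  localised at `η_𝒬`), with Thm 3.5: existence of the lex-maximal centre germ with `a₁ = ord_η X`, realised by a
  weighted chart `(U, u, w)` of a Rees algebra `R` on an open `V ∋ η` with support the closure of `η` in `V`
  (§4 p. 9: global via `𝓘ₙ = 𝒪` away from the centre), and the ORDER DROP at every point of `B₊(U)` over `η`.
* `AbramovichQuekSchober2025_separableBaseChange` — "Moreover, `J` is stable under base change to separable
  field extensions of `k`" (Thm 1.3 (1) / Thm 3.5): after a base change `k'/k` along a SEPARABLE field extension
  (recorded as `Algebra.FormallySmooth k k'` — for fields, formal smoothness IS separability in the sense of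
  EGA 0_IV 19.6.1 / Matsumura, *Commutative Ring Theory*, Thm 26.9; it covers separable algebraic extensions such
  as `k^sep` and separably generated ones such as `k(t₁, …, tₘ)`) the base-changed data `(x ⊗ 1; w; ℓ)` is again
  THE lex-maximal admissible centre germ at every point `η'` over `η` at which the local ring is still
  2-dimensional (all points over `η` when `k'/k` is algebraic; the generic points of the fibre in general — the
  only points where the base-changed local situation `Spec 𝒪 ⊗_k k'` of Thm 3.5 is again 2-dimensional).

NOT recorded (`-- TODO(general form)`): the equivariant Theorem 1.1 as printed — (1) the extension of `J` to a
`T`-invariant centre supported along the whole orbit `𝒬` (§5 (i)(ii): `T(k^sep)`-density) and (2) finiteness of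
the stabilisers of `T' = T × 𝔾ₘ` on `B₊` — which needs the tree's graded-atlas language (Summits-level) and is
left to the consumer as bookkeeping over these two facts; schemes ESSENTIALLY of finite type (recorded: locally of
finite type); the stack-theoretic statements (2) of Thm 1.3 and the destackified scheme-theoretic resolution
(Bergh); the secondary drop of `(a₁, a₂)` (Thm 1.1 (3), second sentence).
SOURCE STATUS: typed and cross-read on the arXiv preprint v1 (1 Jul 2025, 12 pp.; the v1 PDF header title reads "Weighted blow-up
desingularization of plane curves", the arXiv listing title is the bib title); the CURRENT version is **arXiv v3 (9 May 2026,
"Date: May 12, 2026"), whose arXiv comment reads "21 pages; final version, accepted for publication in Math. Scand"** — no DOI /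
journal reference assigned yet and zbMATH still lists «Preprint» (both checked 2026-08-27); see the VERSION NOTE below for what v3
changes (nothing recorded here is affected).  The companion [AQS] = Abramovich–Quek–Schober,
*Weighted blow-up desingularization of plane curves* (arXiv:2412.16426), whose Thm 4.2 the proof of Thm 3.5 follows ("analogous …
we outline the steps"), is published (Beitr. Algebra Geom. 2026, doi:10.1007/s13366-026-00866-6).  Consumers say «modulo
⟨F-AQS-T, arXiv:2507.01232 (v3 = version accepted in Math. Scand.)⟩».  Nothing here is a statement about any manuscript under
adjudication; AI transcription, weaker than expert review.

VERSION NOTE (res-lit-5, 2026-08-27, v3 read on the page: PDF sha256 `07c0bc75…31cf4d`, pymupdf page + line text, deposit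
`HOME/lit/res-lit-5/AQS2025-arXiv2507.01232v3/README.md` with the full v1 → v3 locator table).  Every clause RECORDED in this file is
printed VERBATIM in v3 at: Thm 1.3 (1) p. 3 L16–L20 (Thm 1.1 (1) p. 2 L22–L27); "`δ = ∞` if and only if `f = εy^ν` … the reduction
… is regular" p. 5 L15–L16; Def. 3.2 p. 7 L3–L8; Def. 3.3 p. 7 L17–L33; Rem. 3.4 p. 7 L34–L66; **Thm 3.5 p. 7 L67–L74** (p. 7 L75: "this
theorem implies Theorem 1.3(1)"), proof (a)(b)(c) p. 8 L3–L74 with (c) "`(x₁^{ma₁}, x₂^{ma₂})^{Int} = (y₁^{ma₁}, y₂^{ma₂})^{Int}` for every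
`m`" p. 8 L66–L74, separable base change p. 8 L75 – p. 9 L7; eq. (3.2) and Cor. 3.6 p. 9 L8–L26; Def. 4.1 p. 9 L32–L55, `𝓘ₙ` p. 9 L63,
"This local construction becomes global by setting `𝓘ₙ = 𝒪_S` away from `q`" p. 9 L70; the weighted blow-up `[B₊/𝔾ₘ]`,
`B₊ := B ∖ V(x′₁, x′₂)` is **Def. 4.5** p. 11 L15–L21 in v3 (= v1 Def. 4.3: v3 inserts Rem. 4.2 (centres as extended Rees algebras,
(1)–(4)) and Example 4.3 and renumbers v1's Construction 4.2 / Def. 4.3 / Lemma 4.4 / Def. 4.5 as 4.4 / 4.5 / 4.6 / 4.7; the local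
presentation `R̃ = 𝒪[s, x′₁, x′₂]/(x₁ − s^{w₁}x′₁, x₂ − s^{w₂}x′₂)` is v3 eq. (4.2) p. 10 L51–L63, Construction 4.4 "degenerating to the
weighted normal cone" p. 10 L64 – p. 11 L14, the `𝔾ₘ`-action eq. (4.3) p. 11 L4; Lemma 4.6 p. 11 L28–L30 "proves Theorem 1.3(2)"), the
proper transform is **Def. 4.7** p. 11 L69 (= v1 Def. 4.5);
proof of Thm 1.1 by localisation at `q := η_𝒬` p. 12 L61 – p. 13 L26, §5 (i)/(ii) (`T(k^sep)`-stability, density) p. 13 L3–L16.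
THE ONE CHANGE OF STATEMENT: v3's Thm 1.3 (3) (p. 3 L29–L31) and Thm 1.1 (3) (p. 2 L38–L41) read "The **logarithmic order** of the
proper transform of `C` with respect to the exceptional divisor at every point of the blow-up lying over `q` is strictly smaller than
`a₁`" where v1 said "the order"; v3 proves it on `B₊` (p. 12 L37–L58: "Since the logarithmic order with respect to the exceptional
divisor `{s = 0}` is functorial for smooth morphisms, showing that the logarithmic order drops on `B₊` implies that it drops on the
quotient", "Note that `ν_𝔪(f) ≤ ν^log_𝔪(f)`, where the logarithmic order … is the order where `s ≠ 0` and otherwise it is the order of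
the restriction to `V(s)`") and states "the logarithmic order of the singularity drops at each step, which implies that the order drops
as well" (p. 2 L11–L13).  Hence the ORDER drop on `B₊` recorded in `AbramovichQuekSchober2025_heightTwoCentre` is the WEAKER consequence
of the accepted statement — faithful, never stronger than the source; the logarithmic refinement is not recorded (`-- TODO(general form)`).
-/

noncomputable section

open CategoryTheory AlgebraicGeometry TopologicalSpace IsLocalRing

namespace Literature.AlgebraicGeometry.Resolution

/-- **The lex-maximal admissible weighted centre germ** (Abramovich–Quek–Schober 2025, Def. 3.2–3.3, Thm 3.5,
Def. 4.1, in the tree's monomial-ideal convention).  For a local ring `𝒪`, an ideal `I ⊆ 𝒪` (the stalk of the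
hypersurface), elements `x = (x₀, x₁)`, weights `w = (w₀, w₁)` and a level `ℓ`:
`x` is a regular system of parameters (`(x₀, x₁) = 𝔪`); the REDUCED CENTRE data `J̄ = (x₀^{1/w₀}, x₁^{1/w₁})`,
`J = J̄^ℓ = (x₀^{a₁}, x₁^{a₂})`, `aᵢ = ℓ/wᵢ`, has coprime positive weights, `a₁ ≤ a₂` (`w₁ ≤ w₀`), `a₁ ∈ ℤ`
(`w₀ ∣ ℓ`); `J` is ADMISSIBLE for `I` ("`v_J(f) ≥ 1`", Def. 3.3: `I ⊆ 𝓘_ℓ = (x^α : w·α ≥ ℓ)`); `(a₁, a₂)` is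
LEX-MAXIMAL among all admissible centres `(y₀^{b₁}, y₁^{b₂})`, `b₁ ≤ b₂`, on all regular systems of parameters
`y` (Thm 3.5: "the unique admissible center for `f` for which `(a₁,a₂)` with `a₁ ≤ a₂` attains its maximum with
respect to the lexicographical order", p. 7 L12–L19; eq. (3.1) p. 7 L23–L28; denominators cleared: `bᵢ = ℓ'/w'ᵢ`); and it is UNIQUE: any regular system
of parameters `y` for which the same reduced data `(w, ℓ)` is admissible spans the same Rees filtration
`𝓘ₙ = (y^α : w·α ≥ n) = (x^α : w·α ≥ n)` (Thm 3.5, proof (c), p. 7 L85–L93: "`(x₁^{ma₁}, x₂^{ma₂})^{Int} = (y₁^{ma₁}, y₂^{ma₂})^{Int}`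
for every `m`"). [cite: AbramovichQuekSchober2025, Def. 3.2 (p. 6 L19–L26), Def. 3.3 (p. 6 L31–L46), Rem. 3.4 (p. 6 L47 – p. 7 L11), Thm 3.5 (p. 7 L12–L19, proof p. 7 L21 – p. 8 L40), Def. 4.1 (p. 8 L65–L80) of arXiv:2507.01232v1] -/
def IsLexMaxWeightedCentreGerm (𝒪 : Type) [CommRing 𝒪] [IsLocalRing 𝒪] (I : Ideal 𝒪)
    (x : Fin 2 → 𝒪) (w : Fin 2 → ℕ) (ℓ : ℕ) : Prop :=
  Ideal.span (Set.range x) = maximalIdeal 𝒪 ∧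
  (∀ i, 0 < w i) ∧ Nat.Coprime (w 0) (w 1) ∧ w 1 ≤ w 0 ∧ 0 < ℓ ∧ w 0 ∣ ℓ ∧
  I ≤ weightedMonomialIdeal x w ℓ ∧
  (∀ (y : Fin 2 → 𝒪) (w' : Fin 2 → ℕ) (ℓ' : ℕ), Ideal.span (Set.range y) = maximalIdeal 𝒪 →
    (∀ i, 0 < w' i) → w' 1 ≤ w' 0 → 0 < ℓ' → I ≤ weightedMonomialIdeal y w' ℓ' →
    ℓ' * w 0 < ℓ * w' 0 ∨ (ℓ' * w 0 = ℓ * w' 0 ∧ ℓ' * w 1 ≤ ℓ * w' 1)) ∧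
  (∀ (y : Fin 2 → 𝒪), Ideal.span (Set.range y) = maximalIdeal 𝒪 → I ≤ weightedMonomialIdeal y w ℓ →
    ∀ n : ℕ, weightedMonomialIdeal y w n = weightedMonomialIdeal x w n)

/-- NAMED FACT — **Abramovich–Quek–Schober 2025, Theorem 1.3 (1),(3) at a point of height two (= Theorem 1.1
(1),(3) localised at the generic point of the orbit, §5), with Theorem 3.5.**  Let `Y` be a scheme locally of
finite type over a field `k` (any field, any characteristic), `X` an ideal sheaf on `Y` and `η ∈ Y` a point whose
local ring `𝒪_{Y,η}` is regular of dimension `2`, at which the stalk `X_η` is principal, non-zero, and NOT of the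
form `(y^ν)` for a regular parameter `y` ("`C_red` singular at `q`"; §2 p. 4 L47–L48: "`δ(f;x;y) = ∞` if and only if
`f = ε y^ν` for some unit `ε` … In this case the reduction of `{f = 0}` is regular"; `ν = 0` excludes `X_η = ⊤`, i.e. `η ∈ X`).  Then there are an open
`V ∋ η`, a Rees algebra `R` on `V` and an affine open `U ∋ η` of `V` with a weighted chart `(u₀, u₁; w₀, w₁)` of `R`
(Def. 4.1 p. 8 L65–L80: `J̄ = (x₁^{1/w₁}, x₂^{1/w₂})`, pieces `𝓘ₙ = {g | v_J̄(g) ≥ n}` p. 8 L88) such that: the germs of `u` at `η` with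
`(w, ℓ)` form THE lex-maximal admissible weighted centre germ of `X_η` (`IsLexMaxWeightedCentreGerm`; Thm 1.3 (1):
"There is a well-defined, unique center `J = (x₁^{a₁}, x₂^{a₂})` of maximal invariant `(a₁,a₂)` admissible for
`C ⊂ S` at `q`", p. 2 L49–L53), "where `a₁` is the order of `C` at `q`" (`ℓ/w₀ = ord_η X`); the centre is supported on the
closure of `η` in `V` (§4 p. 9 L3: "This local construction becomes global via `𝓘ₙ = 𝒪_S` away from `q`"; Thm 1.1
(1) p. 2 L10–L13: "supported along `𝒬`"; the chart `(V, U)` is SOME affine neighbourhood of `η`, not a prescribed one); and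
Thm 1.3 (3) (p. 3 L3–L4): "The order of the proper transform of `C` at every point of the
blow-up lying over `q` is strictly smaller than `a₁`" — read on the smooth cover `B₊(U)` of `[B₊/𝔾ₘ]` (§5 p. 11:
"Since the order is functorial for smooth morphisms, showing that the order drops on `B₊` implies that it drops on
the quotient", p. 10 L60–L62).  Recorded for `Y` locally of finite type (printed: essentially of finite type, p. 2 L32–L34); users take
`(h : AbramovichQuekSchober2025_heightTwoCentre)`.
-- TODO(general form): the `T = 𝔾ₘⁿ`-equivariant Theorem 1.1 (extension of `J` along the orbit `𝒬` by
-- `T(k^sep)`-density, finite stabilisers of `T × 𝔾ₘ` on `B₊`), schemes essentially of finite type, the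
-- stack `[B₊/𝔾ₘ]` and Bergh destackification, the drop of the full invariant `(a₁, a₂)`.
[cite: AbramovichQuekSchober2025, Thm 1.3 (1)(3) (p. 2 L46 – p. 3 L4), Thm 1.1 (1)(3) (p. 2 L3–L27), Thm 3.5 (p. 7 L12–L19), Def. 4.1/4.3/4.5 (p. 8 L65 – p. 10 L24), §5 (p. 10 L60 – p. 12 L6) of arXiv:2507.01232v1] -/
def AbramovichQuekSchober2025_heightTwoCentre : Prop :=
  ∀ (k : Type) [Field k] (Y : Scheme.{0}) (f : Y ⟶ Spec (.of k)) [LocallyOfFiniteType f]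
    (X : Y.IdealSheafData) (η : Y),
    IsRegularLocalRing (Y.presheaf.stalk η) →
    ringKrullDim (Y.presheaf.stalk η) = ((2 : ℕ) : WithBot ℕ∞) →
    (stalkIdeal X η).IsPrincipal → stalkIdeal X η ≠ ⊥ →
    (∀ y : Y.presheaf.stalk η, y ∈ maximalIdeal (Y.presheaf.stalk η) →
      y ∉ maximalIdeal (Y.presheaf.stalk η) ^ 2 → ∀ ν : ℕ, stalkIdeal X η ≠ Ideal.span {y ^ ν}) →
    ∃ (V : Y.Opens) (hηV : η ∈ V) (R : ReesAlgebraData (V : Scheme.{0}))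
      (U : (V : Scheme.{0}).affineOpens)
      (hηU : (⟨η, hηV⟩ : (V : Scheme.{0})) ∈ (U : (V : Scheme.{0}).Opens))
      (u : Fin 2 → Γ((V : Scheme.{0}), U)) (w : Fin 2 → ℕ) (ℓ : ℕ),
      R.IsWeightedChart U u w ∧
      IsLexMaxWeightedCentreGerm ((V : Scheme.{0}).presheaf.stalk ⟨η, hηV⟩)
        (stalkIdeal (X.comap V.ι) ⟨η, hηV⟩)
        (fun i => ((V : Scheme.{0}).presheaf.germ (U : (V : Scheme.{0}).Opens) ⟨η, hηV⟩ hηU).hom (u i)) w ℓ ∧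
      (((ℓ / w 0 : ℕ) : ℕ∞) = idealOrder X η) ∧
      (R.support = closure {(⟨η, hηV⟩ : (V : Scheme.{0}))}) ∧
      ∀ b : R.cobordantPlus U, R.cobordantPlusι U b = ⟨η, hηV⟩ →
        idealOrder (R.cobordantStrictTransform U (X.comap V.ι)) b < idealOrder X η

/-- NAMED FACT — **Abramovich–Quek–Schober 2025, Theorem 1.3 (1) / Theorem 3.5, last clause: "Moreover, `J` is
stable under base change to separable field extensions of `k`."**  Recorded: for a field extension `k'/k` that is
SEPARABLE in the sense of EGA 0_IV 19.6.1 / Matsumura Thm 26.9 — i.e. `k'` formally smooth over `k`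
(`Algebra.FormallySmooth k k'`; separable algebraic extensions and separably generated ones such as
`k(t₁, …, tₘ)` are instances) —, the base change `Y' = Y ×_k k' → Y` (a pullback square) and a point `η'` over a
point `η` as in `AbramovichQuekSchober2025_heightTwoCentre` AT WHICH `𝒪_{Y',η'}` IS STILL 2-DIMENSIONAL (every
point over `η` if `k'/k` is algebraic; the generic points of the fibre in general: exactly the points where the
base change `Spec 𝒪_{Y,η} ⊗_k k'` of the printed local situation is again a regular 2-dimensional scheme), the
image in `𝒪_{Y',η'}` of a lex-maximal admissible weighted centre germ `(x; w; ℓ)` of `X_η` is THE lex-maximal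
admissible weighted centre germ of `(X𝒪_{Y'})_{η'}` (same reduced data `(w, ℓ)`; proof p. 7 L94 – p. 8 L40: "Let `k'/k` be a
separable extension … the characteristic polyhedron does not change under the base change `k'/k` and thus `J`
remains stable").  This is the clause the equivariant Theorem 1.1 (1) uses (§5 (i), p. 11 L16–L21: "`J` remains
the unique center of maximal invariant … for `C ×_k k^sep ⊂ S ×_k k^sep` at `q` … by the uniqueness of `J`,
`t · J = J`"; a torus-chart consumer uses `k' = k(t₁, …, tₘ)` at the generic point of `T × 𝒬`).  Users take
`(h : AbramovichQuekSchober2025_separableBaseChange)`.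
[cite: AbramovichQuekSchober2025, Thm 1.3 (1) (p. 2 L52–L53), Thm 3.5 (p. 7 L18–L19, proof p. 7 L94 – p. 8 L40), §5 (i) (p. 11 L16–L21) of arXiv:2507.01232v1] -/
def AbramovichQuekSchober2025_separableBaseChange : Prop :=
  ∀ (k : Type) [Field k] (Y : Scheme.{0}) (f : Y ⟶ Spec (.of k)) [LocallyOfFiniteType f]
    (X : Y.IdealSheafData)
    (k' : Type) [Field k'] [Algebra k k'] [Algebra.FormallySmooth k k']
    (Y' : Scheme.{0}) (f' : Y' ⟶ Spec (.of k')) (g : Y' ⟶ Y),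
    IsPullback g f' f (Spec.map (CommRingCat.ofHom (algebraMap k k'))) →
    ∀ (η' : Y'), ringKrullDim (Y'.presheaf.stalk η') = ((2 : ℕ) : WithBot ℕ∞) →
    IsRegularLocalRing (Y.presheaf.stalk (g.base η')) →
    ringKrullDim (Y.presheaf.stalk (g.base η')) = ((2 : ℕ) : WithBot ℕ∞) →
    (stalkIdeal X (g.base η')).IsPrincipal → stalkIdeal X (g.base η') ≠ ⊥ →
    (∀ y : Y.presheaf.stalk (g.base η'), y ∈ maximalIdeal (Y.presheaf.stalk (g.base η')) →
      y ∉ maximalIdeal (Y.presheaf.stalk (g.base η')) ^ 2 → ∀ ν : ℕ,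
        stalkIdeal X (g.base η') ≠ Ideal.span {y ^ ν}) →
    ∀ (x : Fin 2 → Y.presheaf.stalk (g.base η')) (w : Fin 2 → ℕ) (ℓ : ℕ),
      IsLexMaxWeightedCentreGerm (Y.presheaf.stalk (g.base η')) (stalkIdeal X (g.base η')) x w ℓ →
      IsLexMaxWeightedCentreGerm (Y'.presheaf.stalk η') (stalkIdeal (X.comap g) η')
        (fun i => (g.stalkMap η').hom (x i)) w ℓ

end Literature.AlgebraicGeometry.Resolution

end
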